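import Summits.QuantumAdvantage.QuantumAdvantage.Theorems.CubicForrelationNearExactIsExactRothaus
import Summits.QuantumAdvantage.QuantumAdvantage.Theorems.CubicForrelationNearExactIsExactDerivDegree

/-!
# Crux `CubicForrelation.NearExactIsExact` (stmt-QuantumAdvantage-14043) — the unconditional small-`n` bent band

Line `direct-sum-amplification`, OPEN stub `stub_bentSidedBand` (bent branch). Two one-line assemblies of landed
pieces (`…Rothaus.lean`: Rothaus' bound `bb_rothaus_isDegLeFun` and `bb_band_small_m_of_derivDegree`;
`…RmWeight.lean`: `stub_rmWeight`; `…DerivDegree.lean`: `stub_derivDegree`):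

* `bb_rmWeight_holds`: the Reed–Muller minimum-weight statement, unconditionally (`stub_rmWeight stub_derivDegree`):
  a Boolean function of degree `≤ d` on `m` bits that is `1` somewhere has weight `≥ 2^{m−d}` (division-free).
* `bb_band_unconditional_small_m`: for `2 ≤ m ≤ 6` (`4 ≤ n ≤ 12`), every cubic `f` and every bent `g` on `m + m`
  bits have `Φ(f,g) = 1 ∨ Φ(f,g) ≤ 31/32` — NO Hou-type hypothesis: the dual `g̃` is bent, so `deg g̃ ≤ m ≤ 6` by
  Rothaus, and the word `f ⊕ g̃` of degree `≤ 6` is `0` or has weight `≥ 2^{n−6}`. (The hypothesis `2 ≤ m` is not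
  needed — `bb_band_small_m_of_derivDegree` covers all `m ≤ 6` — but it is the registered shape.)

Sources: O. S. Rothaus, On "bent" functions, JCTA 20 (1976); C. Carlet, Boolean Functions for Cryptography and
Coding Theory (CUP 2021), Thm 7 (RM minimum distance), Thm 13 (degree of bent functions), §6.1 (duals).
-/

set_option linter.dupNamespace false -- D-0017: single-problem summit

noncomputable section

namespace Summit.QuantumAdvantage.QuantumAdvantage.Theorems.CubicForrelation.NearExactIsExact

open Finset
open Literature.Computability.QuantumComplexity
open Literature.Computability.QuantumComplexity.BuzetChailloux (bxor zeroVec signOf_sq)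
open Literature.Computability.QuantumComplexity.DerivativeWalsh (W)

/-- **The Reed–Muller minimum weight, unconditionally** (Carlet 2021 Thm 7; MacWilliams–Sloane Ch. 13 §3): a Boolean
function `e` of algebraic degree `≤ d` on `m` bits with `e x = 1` for some `x` satisfies `2^m ≤ 2^d · #{x : e x = 1}`.
Assembled from the landed stubs R (`stub_rmWeight`) and D (`stub_derivDegree`). -/
theorem bb_rmWeight_holds :
    ∀ (m d : ℕ) (e : (Fin m → Bool) → Bool), IsDegLeFun d e → (∃ x, e x = true) →
      2 ^ m ≤ 2 ^ d * (univ.filter fun x => e x = true).card :=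
  stub_rmWeight stub_derivDegree

/-- **The unconditional small-`n` bent band.** For `2 ≤ m ≤ 6`, every cubic `f` and every bent `g`
(`W_g(x)² = 2^{m+m}` for all `x`) on `m + m` bits satisfy `Φ(f,g) = 1 ∨ Φ(f,g) ≤ 31/32`; no Maiorana–McFarland or
Hou-type hypothesis (Rothaus' bound on the bent dual, `bb_band_small_m_of_derivDegree stub_derivDegree`). So the band
of `stub_bentSidedBand` can only fail from `n = 14` on. -/
theorem bb_band_unconditional_small_m :
    ∀ (m : ℕ) (f g : (Fin (m + m) → Bool) → Bool), 2 ≤ m → m ≤ 6 → IsDegLeFun 3 f →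
      (∀ x, W (fun y => signOf (g y)) x ^ 2 = (2 : ℝ) ^ (m + m)) →
      forrelation f g = 1 ∨ forrelation f g ≤ 31 / 32 :=
  fun m f g _ hm6 hf hbent => bb_band_small_m_of_derivDegree stub_derivDegree m hm6 f g hf hbent

end Summit.QuantumAdvantage.QuantumAdvantage.Theorems.CubicForrelation.NearExactIsExact
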